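/-
Copyright: the b2b-balaban T⁴-continuum CRUX team, row NE7b OWNER lineage `t4-ne7b-p1` (gen 105). Project licence.
-/
import Summits.QuantumFields.BalabanUV.T4Continuum.Spine.NE7b.GaussianShiftedFibre

/-!
# The TRANSLATED large-field mass: the second hypothesis of `GaussianShiftedFibre.shiftedMoment_le` (`η < 1` for the restriction
# translated by the induced mean) ALSO reduces to induced-mean energies — so residual (R1′) is (R1″) alone (row NE7b, node U5c)

Cell `pub-balaban`, sub-cell `t4`, spine estimate NE7b (`T4WeightBudget.RelWeightBound`; the cell's OWN estimate — NOT PRINTED in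
[Bałaban 1983–89], NOT PROVED).  Crux-route work under `Spine/NE7b/` by the row's OWNER; NOTHING of Bałaban's is named or asserted;
no `T4Continuum/Support` leaf typed; zero `sorry`.

WHY.  `…GaussianShiftedFibre.shiftedMoment_le` prices the shifted near-block restricted moment by TWO displayed quantities: the induced-mean
energy `mᵀQm` of the sacrificed form (entering as `e^{(1+ε⁻¹)mᵀQm}`) and the large-field mass `η` of the TRANSLATED restriction `F(· − m)`
under the centred Gaussian.  THIS FILE shows the second is of the same nature as the first: if `1 − F ≤ Σ_b 𝟙{θ_b ≤ xᵀQ_b x}` (the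
restriction collects finitely many large-field conditions, each a `δ`-dominated form `Q_b` of rank `≤ r_b`), then by Young's inequality a
translated condition `θ_b ≤ (u−m)ᵀQ_b(u−m)` forces the CENTRED condition `θ_b' ≤ uᵀQ_b u` with the LOWERED THRESHOLD
`θ_b' = (θ_b − (1+ε⁻¹)·mᵀQ_b m) ∕ (1+ε)`, and the union bound × Gaussian tail of `…GaussianRestrictedMoment.largeFieldMass_le` gives
**`η ≤ Σ_b e^{−θ_b'}·(√(1−δ))⁻¹ ^ {r_b}`** — small as long as the induced-mean energies `mᵀQ_b m` stay below a fixed fraction of the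
thresholds («thresholds versus the induced mean»: print's maximum principle for the small-field Green's function).  Hence the decoupling
residual (R1′) of `…GaussianFibrewiseDecoupling` reduces ENTIRELY to (R1″): bounds on the induced-mean energies `mᵀQm`, `mᵀQ_b m` on the
pinned region and its conditions, uniformly over the far small-field configurations (`m = S₁₁⁻¹S₁₂x₂`).

WHAT IS PROVED ([folklore]): `qf_lower_of_translate` (Young read backwards: `θ ≤ (u−m)ᵀQ(u−m) ⟹ (θ − (1+ε⁻¹)mᵀQm)∕(1+ε) ≤ uᵀQu`),
`indicator_translate_le` (the translated condition's indicator is below the centred lowered-threshold indicator),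
**`translatedLargeFieldMass_le`** (the bound on `η` above), and the packaging **`shiftedMoment_le_of_inducedMeans`**
(`shiftedMoment_le` with BOTH hypotheses discharged from induced-mean energy bounds: `mᵀQm ≤ B₀` and `Σ_b e^{−θ_b'}(√(1−δ))⁻¹^{r_b} ≤ η < 1`).

NOT HERE (honest): the induced-mean energy bounds for Bałaban's kernels ((R1″): `M R_k` margins + Green's function decay ∕ maximum principle —
leaf-06's `kappa_of_finiteRange_smallField` is the first model supplier); the non-Gaussian remainder (R2); anything of Bałaban's.  NE7b NOT
PRINTED ∕ NOT PROVED; spine PROVED 0∕9; rung (B)+1 on a FINITE torus — NOT infinite volume, NOT the mass gap, NOT Clay.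
HONEST DEPENDENCY: continuum YM on T⁴ ⇐ BetaPertH ∧ nine spine estimates (0/9 proved); BetaPertH ⇐ (D1) ∧ (D4) ∧ CAP+tail.
-/

set_option autoImplicit false

open Matrix Finset MeasureTheory Real
open Summit.QuantumFields.BalabanUV.T4Continuum.NE7b.QuadFormSimDiag
open Summit.QuantumFields.BalabanUV.T4Continuum.NE7b.GaussianDominatedMoment
open Summit.QuantumFields.BalabanUV.T4Continuum.NE7b.GaussianRestrictedMoment
open Summit.QuantumFields.BalabanUV.T4Continuum.NE7b.GaussianShiftedFibre

namespace Summit.QuantumFields.BalabanUV.T4Continuum.NE7b.GaussianTranslatedMass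

variable {n : Type*} [Fintype n] [DecidableEq n]

omit [DecidableEq n] in
/-- **YOUNG READ BACKWARDS**: a translated large-field condition forces a centred one with a lowered threshold —
`θ ≤ (u−m)ᵀQ(u−m) ⟹ (θ − (1+ε⁻¹)·mᵀQm) ∕ (1+ε) ≤ uᵀQu` (`Q` positive semidefinite, `ε > 0`). [folklore] -/
theorem qf_lower_of_translate {Q : Matrix n n ℝ} (hQ : Q.PosSemidef) {θ ε : ℝ} (hε : 0 < ε) (u m : n → ℝ)
    (h : θ ≤ (u - m) ⬝ᵥ (Q *ᵥ (u - m))) :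
    (θ - (1 + ε⁻¹) * (m ⬝ᵥ (Q *ᵥ m))) / (1 + ε) ≤ u ⬝ᵥ (Q *ᵥ u) := by
  have hy := qf_young hQ u m hε
  rw [div_le_iff₀ (by linarith : (0 : ℝ) < 1 + ε)]
  linarith

omit [DecidableEq n] in
/-- The translated condition's indicator is dominated by the centred lowered-threshold indicator. [folklore] -/
theorem indicator_translate_le {Q : Matrix n n ℝ} (hQ : Q.PosSemidef) (θ : ℝ) {ε : ℝ} (hε : 0 < ε) (u m : n → ℝ) :
    Set.indicator {x : n → ℝ | θ ≤ x ⬝ᵥ (Q *ᵥ x)} (fun _ => (1 : ℝ)) (u - m) ≤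
      Set.indicator {x : n → ℝ | (θ - (1 + ε⁻¹) * (m ⬝ᵥ (Q *ᵥ m))) / (1 + ε) ≤ x ⬝ᵥ (Q *ᵥ x)} (fun _ => (1 : ℝ)) u := by
  by_cases h : θ ≤ (u - m) ⬝ᵥ (Q *ᵥ (u - m))
  · have h' : (θ - (1 + ε⁻¹) * (m ⬝ᵥ (Q *ᵥ m))) / (1 + ε) ≤ u ⬝ᵥ (Q *ᵥ u) := qf_lower_of_translate hQ hε u m h
    rw [Set.indicator_of_mem (show u - m ∈ {x : n → ℝ | θ ≤ x ⬝ᵥ (Q *ᵥ x)} from h),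
      Set.indicator_of_mem (show u ∈ {x : n → ℝ | _ ≤ x ⬝ᵥ (Q *ᵥ x)} from h')]
  · rw [Set.indicator_of_notMem (show u - m ∉ {x : n → ℝ | θ ≤ x ⬝ᵥ (Q *ᵥ x)} from h)]
    exact Set.indicator_nonneg (fun _ _ => zero_le_one) u

/-- **THE TRANSLATED LARGE-FIELD MASS IS SMALL WHEN THE INDUCED-MEAN ENERGIES ARE BELOW THE THRESHOLDS.**  If the restriction collects
finitely many large-field conditions, `1 − F(x) ≤ Σ_{b ∈ B} 𝟙{θ_b ≤ xᵀQ_b x}`, each `Q_b` positive semidefinite, `δ`-dominated by the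
positive-definite `S` and of rank `≤ r_b`, then for every translation `m` and every `ε > 0` the translated mass obeys
`∫ (1 − F(u − m)) e^{−uᵀSu} ≤ (Σ_b e^{−(θ_b − (1+ε⁻¹)mᵀQ_b m)∕(1+ε)}·(√(1−δ))⁻¹ ^ {r_b}) · ∫ e^{−uᵀSu}`. [folklore] -/
theorem translatedLargeFieldMass_le {ι : Type*} (B : Finset ι) {S : Matrix n n ℝ} (Qb : ι → Matrix n n ℝ) (θ : ι → ℝ)
    (rb : ι → ℕ) {δ ε : ℝ} (hS : S.PosDef) (hQ : ∀ b ∈ B, (Qb b).PosSemidef) (hdom : ∀ b ∈ B, (δ • S - Qb b).PosSemidef)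
    (hδ0 : 0 ≤ δ) (hδ : δ < 1) (hr : ∀ b ∈ B, (Qb b).rank ≤ rb b) (hε : 0 < ε) {F : (n → ℝ) → ℝ} (hF1 : ∀ x, F x ≤ 1)
    (hcov : ∀ x, 1 - F x ≤ ∑ b ∈ B, Set.indicator {x | θ b ≤ x ⬝ᵥ (Qb b *ᵥ x)} (fun _ => (1 : ℝ)) x) (m : n → ℝ) :
    ∫ u, (1 - F (u - m)) * exp (-(u ⬝ᵥ (S *ᵥ u))) ≤
      (∑ b ∈ B, exp (-((θ b - (1 + ε⁻¹) * (m ⬝ᵥ (Qb b *ᵥ m))) / (1 + ε))) * (√(1 - δ))⁻¹ ^ rb b) *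
        ∫ u, exp (-(u ⬝ᵥ (S *ᵥ u))) := by
  refine largeFieldMass_le B Qb (fun b => (θ b - (1 + ε⁻¹) * (m ⬝ᵥ (Qb b *ᵥ m))) / (1 + ε)) rb hS hQ hdom hδ0 hδ hr
    (F := fun u => F (u - m)) (fun u => hF1 _) fun u => ?_
  calc 1 - F (u - m) ≤ ∑ b ∈ B, Set.indicator {x | θ b ≤ x ⬝ᵥ (Qb b *ᵥ x)} (fun _ => (1 : ℝ)) (u - m) := hcov (u - m)
    _ ≤ ∑ b ∈ B, Set.indicator {x : n → ℝ | (θ b - (1 + ε⁻¹) * (m ⬝ᵥ (Qb b *ᵥ m))) / (1 + ε) ≤ x ⬝ᵥ (Qb b *ᵥ x)}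
          (fun _ => (1 : ℝ)) u :=
        Finset.sum_le_sum fun b hb => indicator_translate_le (hQ b hb) (θ b) hε u m

/-- **BOTH HYPOTHESES OF `shiftedMoment_le` FROM INDUCED-MEAN ENERGIES** (residual (R1′) is (R1″) alone): with the induced mean
`m = S⁻¹v`, a bound `mᵀQm ≤ B₀` for the sacrificed form and `Σ_b e^{−(θ_b − (1+ε⁻¹)mᵀQ_b m)∕(1+ε)}(√(1−δ))⁻¹^{r_b} ≤ η < 1` for the
restriction's conditions give the shifted restricted moment bound `e^{(1+ε⁻¹)B₀}·(√(1−δ'))⁻¹ ^ r ∕ (1 − η)`. [folklore] -/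
theorem shiftedMoment_le_of_inducedMeans {ι : Type*} (B : Finset ι) {S Q : Matrix n n ℝ} (Qb : ι → Matrix n n ℝ) (θ : ι → ℝ)
    (rb : ι → ℕ) {δ δ' ε η B₀ : ℝ} {r : ℕ} (hS : S.PosDef) (hQ : Q.PosSemidef) (hε : 0 < ε)
    (hdom : (δ' • S - (1 + ε) • Q).PosSemidef) (hδ'0 : 0 ≤ δ') (hδ' : δ' < 1) (hr : Q.rank ≤ r)
    (hQb : ∀ b ∈ B, (Qb b).PosSemidef) (hdomb : ∀ b ∈ B, (δ • S - Qb b).PosSemidef) (hδ0 : 0 ≤ δ) (hδ : δ < 1)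
    (hrb : ∀ b ∈ B, (Qb b).rank ≤ rb b) (v : n → ℝ) {F : (n → ℝ) → ℝ} (hF0 : ∀ x, 0 ≤ F x) (hF1 : ∀ x, F x ≤ 1)
    (hFm : Measurable F) (hcov : ∀ x, 1 - F x ≤ ∑ b ∈ B, Set.indicator {x | θ b ≤ x ⬝ᵥ (Qb b *ᵥ x)} (fun _ => (1 : ℝ)) x)
    (hη : η < 1)
    (hηb : ∑ b ∈ B, exp (-((θ b - (1 + ε⁻¹) * ((S⁻¹ *ᵥ v) ⬝ᵥ (Qb b *ᵥ (S⁻¹ *ᵥ v)))) / (1 + ε))) * (√(1 - δ))⁻¹ ^ rb b ≤ η)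
    (hB : (S⁻¹ *ᵥ v) ⬝ᵥ (Q *ᵥ (S⁻¹ *ᵥ v)) ≤ B₀) :
    ∫ x, F x * (exp (x ⬝ᵥ (Q *ᵥ x)) * exp (-(x ⬝ᵥ (S *ᵥ x) + 2 * (x ⬝ᵥ v)))) ≤
      (exp ((1 + ε⁻¹) * B₀) * ((√(1 - δ'))⁻¹ ^ r / (1 - η))) * ∫ x, F x * exp (-(x ⬝ᵥ (S *ᵥ x) + 2 * (x ⬝ᵥ v))) := by
  refine shiftedMoment_le_of_inducedMean_le hS hQ hε hdom hδ'0 hδ' hr v hF0 hF1 hFm hη ?_ hB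
  refine (translatedLargeFieldMass_le B Qb θ rb hS hQb hdomb hδ0 hδ hrb hε hF1 hcov (S⁻¹ *ᵥ v)).trans ?_
  exact mul_le_mul_of_nonneg_right hηb (integral_exp_neg_qf_pos hS).le

end Summit.QuantumFields.BalabanUV.T4Continuum.NE7b.GaussianTranslatedMass
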